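import Summits.BirchSwinnertonDyer.Rank1Residual.O5.O5DepletedCongruence
import Summits.BirchSwinnertonDyer.Rank1Residual.O5.O5Targets
import Summits.BirchSwinnertonDyer.Rank1Residual.Additive.FouquetWanLocus
import HarnessLib

/-!
# O5 — GEN 3: the local shape at the tame `e = 4` prime `3`, the COMPANION laws, route T-O5-GV
# (Kato's IMC for the generic type-III* member by transport from its ordinary companion) and the
# census law T14

Add-on to `O5DepletedCongruence` (T13, p260013), `O5Targets` (T-O5-A shells over the interface `KMC`,
p250903) and `Additive/FouquetWanLocus` (`LocIrr`, p252259).  Census cell O5 = (t′), o5-r1 GEN 3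
(planner-b2b-bsdres-o5-r1-g3-0, 2026-08-21).  HONEST FRAMING: every node below is a `def … : Prop`
(THEOREM-CANDIDATE with its printed sources) or an `@[conjecture] def` (census-mined law / research
crux); nothing is asserted, nothing booked, census numbers are EVIDENCE; no main conjecture is an input of
any certificate.  Details and numbers: `HOME/cells/o5o6/TARGETS.md` §O5 '#### o5-r1 GEN 3' (G3-1 … G3-7).

## G3-1 LOCAL SHAPE AT (t′), p = 3 (THEOREM-CANDIDATE, in words — the semisimplification characters are not
## yet tree vocabulary; the typeable corollaries are `LocalShapeTprimeThree`, `CompanionTypeLawThree`)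
For `W ∈ O5b` (additive at `3`, tame, `e = 4`, Kodaira III / III*) let `L = ℚ₃^nr(3^{1/4})` (good
supersingular model, formal group `F` of height 2, `e_L = 4`).  Serre 1972 §1.11 on `[3]_F` over `O_L`:
(A) single-slope Newton polygon ⇒ `W[3]|I_L = ω_{2,L}^4 ⊕ ω_{2,L}^{12}`, and `det = ω` forces the `I_{ℚ₃}`-characters
`{ω₂, ω₂³} ⊗ ω^a`, Frobenius-unstable ⇒ `ρ̄ := W[3]|G_{ℚ₃}` IRREDUCIBLE (`LocIrr W 3`);
(B) broken polygon ⇒ the break is `v₁ = 2` (a `G_{ℚ₃}`-stable line carries an `𝔽₃^×`-valued character, and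
`ω|I_L = 1 ≠ ω_{1,L}`), `I_L` acts unipotently and `ρ̄ ≅ u ⊗ (ω c; 0 1) ⊗ ω^a`, `u` unramified quadratic,
`a ∈ {0,1}`, `c ∈ H¹(ℚ₃, ω)`;
(C) `T₃W` is a potentially Barsotti–Tate lift of the cuspidal tame type `ω̃₂² ⊕ ω̃₂⁶`, whose reduction has
Jordan–Hölder factors `{1, det}` (Diamond), so (BDJ recipe ⟸ existence of the lift: Savitt 2005, Gee–Kisin)
`ρ̄ ⊗ ω^{−a}` is FINITE FLAT for one `a`: in (B) `c` is PEU RAMIFIÉ (or `0`), in (A) the flat twist is the one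
with characters `{ω₂, ω₂³}`.
COROLLARIES: at `p = 3` Fouquet–Wan's (Lgl) "ss(ρ̄|G_{ℚ₃}) ≠ χ ⊕ χχ_cyc" ⟺ `LocIrr` EXACTLY (every reducible
`ρ̄` over `𝔽₃` has ss `= u ⊕ uω`), so the "reducible-but-(Lgl)" branch of `FouquetWanLocus` is EMPTY for
elliptic curves; the census selector `7 ≤ v₃(j − 1728)` of T9 is (A) (`SelectorIdentityTameThree`, p255094).
[cite: Serre1972, §1.11 Prop. 10 and §1.8] [cite: BuzzardDiamondJarvis2010, §3] [cite: Savitt2005, Thm. 6.x (locator to be fixed)]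

## G3-2 COMPANIONS (census: cc-eng-2 `class-closure/O5/cong-eng2-links.tsv`, all `p = 3` links with a
## partner of conductor prime to or exactly divisible by `3`; EVIDENCE, screened not Sturm-certified)
On O5b (Kodaira III / III*): LocIrr rows → good-SUPERSINGULAR companions only (33 204 links / 1 620 curves;
good-ordinary 0, multiplicative 0); generic rows → good-ORDINARY (27 998 links: 14 429 non-anomalous, 13 569
anomalous) and MULTIPLICATIVE (19 765 links, split 9 649 / non-split 10 116) companions, good-supersingular 0.
The semistable-at-3 companion attaches to the KODAIRA-III* member: III* rows 4 312 / 4 317 have one, III rows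
17 / 3 042 — all 17 being LocIrr rows of image 3Nn (`ρ̄ ≅ ρ̄ ⊗ ω`, so the III* twin's companion is shared).
SCREEN ARTEFACT (anomaly A-O5-G3-2, this seat, direct point counts): the 64 further links of 14 generic type-III
rows in the 24-prime (`ℓ ≤ 97`) screen — incl. the one generic ↔ good-ss link 446292ck1 ↔ 122150ba — ALL fail at
19–35 primes `97 < ℓ ≤ 400` (0 / 64 genuine), while the 40 T14 pairs below pass 72–75 primes `ℓ ≤ 400`.
SPLITTING NEVER OCCURS: `ψ₃` has exactly one `ℚ₃`-root on 61 / 61 generic rows and none on 10 / 10 LocIrr rows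
(kit j129977) — `NonSplitAtThreeLaw` below, with its two-line Newton-polygon proof sketch.

## G3-4 ROUTE T-O5-GV (E3; research route = T-O5-A's first proof route on the generic sub-class)
For the generic (`¬ LocIrr`) type-III* member `W*` with ordinary companion `g` (or multiplicative `h`):
Kato's IMC 12.10 for `f_{W*}` on both `Δ`-branches by CONGRUENCE TRANSPORT in Kato's `ℍ¹/ℍ²`-zeta formulation
— C.-H. Kim, arXiv:1909.01764, Thm 2.1 (`p` odd, `2 ≤ k ≤ p − 1`, `SL₂(𝔽_p) ⊆ im ρ̄`; `μ(ℍ¹/z) = 0` for ONE form ⇒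
for all, `λ(ℍ¹/z) − λ(ℍ²)` CONSTANT on `S_k(ρ̄)`, IMC for one ⇒ for all) with its one failing hypothesis
`p ∤ level` removed.  Cruxes: GV1 fine-Selmer / `ℍ²` transport incl. the `9M′`-new point (provable);
GV2 `KatoDefectConstancyThree` below (research; obstacle: mod-3 multiplicity TWO at `9 ∥ N`, o5-r2's
F-O5-M2 — the two `3`-old vectors span the `U₃`-kernel mod `3`); GV3 the local term at `3`.  Then the tree
shell `PotSupersingularLowerHalfRankZeroOfKMC` (p250903) + Kato UPPER give `MissingPPartAt W* 3` in rank 0, and the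
type-III twin by the branch swap (T8).  Not reachable by Fouquet–Wan Thm 5.1 ((Lgl) fails on every generic row)
nor by Nakamura arXiv:2006.13647 Thm 1.1 (`p ≥ 5`; hyp. (4) excludes `χ ⊗ (1 ∗; 0 ε̄⁻¹)`).
[cite: Kim2019KatoInvariants, Thm. 2.1] [cite: EmertonPollackWeston2006, Thm. 1] [cite: GreenbergVatsal2000, §2]
[cite: FouquetWan2021, Thm. 5.1] [cite: Kato2004Asterisque, Thm. 12.5 pp. 221–222 and Conj. 12.10 p. 224]

## G3-8 EXACT MOD-3 TRANSPORT (T15, EXPLORATORY — mined from the j129977 vectors after T14 passed; held-out test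
## = the next job; typed because it names the old vector GV2 must transport)
For ORDINARY companions the `S`-depleted layer elements satisfy, coefficientwise mod `3` and up to sign,
`θ̄^ε_{n,S}(W*) = ± ν_{n−1→n}(θ̄^ε_{n−1,S}(G))` — all `3^n` coefficients on 84 / 84 instances (28 pairs,
`n ∈ {4,5}`, both branches): the supercuspidal newform's mod-3 symbol on `3`-power cusps is that of the old form
`g(3z)` (the `w₉`-eigen old line), NOT of the `q`-expansion-congruent `U₃`-kernel vector `g − a₃ g(3z)`.
For MULTIPLICATIVE companions the same identity holds only modulo relative degree `2·3^{n−2}` (29 / 29), the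
exact old vector there is open.  T15 ⇒ T14♯ (ordinary case) ⇒ T14.

## TYPER PLACEMENT NOTE (cc-typer-5 GEN 4, typer of record O5 §3.5 / O6 §3.4, 2026-08-21)
Landed from o5-r1 GEN 3's file `HOME/b2b-bsdres-o5-r1/gen3/O5CompanionTransport.lean` (sha16
67db2651e7bd0fbb, 410 lines, the 10:53Z ADDENDUM revision superseding bdf5ffe714cc0325; ASK A-O5-15)
VERBATIM below this note, EXCEPT one lint-forced SPLIT BY TOPIC (gate rule: Theorems files ≤ 400 lines):
§4 GV2 (`KatoIwasawaInvariants`, `katoDefect`, section `Interface`, `@[conjecture] KatoDefectConstancyThree`,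
`kmc_of_companion` — o5-r1's lines 309–406, byte-identical) lives in the sibling module
`O5.O5KatoDefect`, which imports this one; §§1–3b stay here unchanged. TYPER CHECK: `IsCompanionAtThree`
/ `numStableLinesAtThree` / `normLiftThree` are definitions with bodies; `LocalShapeTprimeThree`,
`NonSplitAtThreeLaw`, `CompanionTypeLawThree` are THEOREM-CANDIDATES (plain `def … : Prop`, Serre §1.11 —
to be PROVED, never consumed as hypotheses; STATUS ⟦cc-typer-5 GEN 17⟧: G3-1 PROVED p291075, G3-2 PROVED p337182 — see their docstrings); `FlatMemberLawThree`, T14 `CompanionLambdaTransportLawThree`,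
T14♯ `CompanionLambdaTransportExactThree`, T15 `ModThreeLayerTransportThree` are `@[conjecture]` EVIDENCE
items (T14 PRE-REGISTERED and PASSED κ ≡ 0, 84/84 + 32/32, kit j129977; T14♯ read off that run and
confirmed on its held-out half; T15 EXPLORATORY — mined post hoc, held-out test = the next job, typed because
it names the old vector GV2 transports; none refuted on its own census, so all typeable). DEDUP STANCE (typer
of record): T14/T14♯/T15 are the O5b-with-SEMISTABLE-companion members of the 'λ-transport along a mod-3
congruence' family (T11 `O5.CongruenceTransportLawThree`, T13 `O5.DepletedCongruenceLawThree`, (G3-15)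
`Additive.MazurTateLambdaCongruenceThree branch`, `Additive.CompanionLambdaShiftThree{,PW}`) — SIBLINGS
(different binders: depleted elements, twist shift `2·3^{n−1}`), none merged. `IsCompanionAtThree` (O5,
congruence at all good `ℓ`, partner semistable at 3) and `Additive.IsCompanionThree` (O6, `W[3] ≅ A[3]`,
partner GOOD at 3) are deliberately distinct predicates of their authors; no unification attempted here.
Audit marks expected: `conjecture` 4, `vendored-fact` on the three theorem-candidates (two of them, G3-1 and G3-2, are now PROVED in
sibling leaves p291075 / p337182 — the marks of THIS file are unchanged, the proofs live elsewhere), `orphan` on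
`companionLambdaTransportLawThree_of_exact`. 0 named Literature facts; census numbers are EVIDENCE; nothing
booked; no mark of `RESIDUAL-MAP.md` moves.
-/

set_option autoImplicit false

noncomputable section

open scoped Classical MatrixGroups ModularForm NumberField

open CongruenceSubgroup Polynomial WeierstrassCurve NumberField Literature.NumberTheory.EllipticCurves
  Literature.NumberTheory.EllipticCurves.ModularForms
  Summit.BirchSwinnertonDyer.Rank1Residual.Additive

namespace Summit.BirchSwinnertonDyer.Rank1Residual.O5

/-! ## §1 Vocabulary: elliptic companions at 3 and the number of `G_{ℚ₃}`-stable lines -/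

/-- `G` is an (elliptic) **semistable companion of `W` at `3`**: `G` is SEMISTABLE at `3` (`9 ∤ N_G`:
good or multiplicative reduction) and `a_ℓ(W) ≡ a_ℓ(G) (mod 3)` at every prime `ℓ ∤ 3·N_W·N_G` (so
`ρ̄_G^{ss} ≅ ρ̄_W^{ss}` by Brauer–Nesbitt–Chebotarev; with `ρ̄_W` irreducible, `ρ̄_G ≅ ρ̄_W`).  The census
object of cc-eng-2's link table (partners SCREENED at ≤ 24 primes `ℓ ≤ 97` — see the screen artefact in the
module docstring: a typed instance needs the congruence at ALL `ℓ`, in practice a Sturm-bound certificate).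
[folklore] -/
def IsCompanionAtThree (W G : WeierstrassCurve ℚ) [W.IsElliptic] [W.IsGloballyMinimal]
    [G.IsElliptic] [G.IsGloballyMinimal] : Prop :=
  ¬ 9 ∣ G.conductorNorm ℤ ∧
    ∀ ℓ : ℕ, ℓ.Prime → ¬ (ℓ ∣ 3 * W.conductorNorm ℤ * G.conductorNorm ℤ) →
      ((W.LFunction ℓ : ℤ) : ZMod 3) = ((G.LFunction ℓ : ℤ) : ZMod 3)

/-- The number of **`G_{ℚ₃}`-stable lines in `W[3]`** = the number of roots in `ℚ₃` of the 3-division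
polynomial `Ψ₃` (a subgroup `{0, ±P}` of order `3` is `G_{ℚ₃}`-stable iff `x(P) ∈ ℚ₃`).  Census-decidable
(PARI `polrootspadic(elldivpol(E,3),3,r)`); `0` = `LocIrr`, `1` = reducible non-split, `2` = split.
[folklore] -/
noncomputable def numStableLinesAtThree (W : WeierstrassCurve ℚ) : ℕ :=
  ((W.Ψ₃).map (algebraMap ℚ ℚ_[3])).roots.toFinset.card

/-! ## §2 G3-1 (typeable part) and G3-2: local shape, companion type, flat member -/

/-- **G3-1, typeable corollary (THEOREM-CANDIDATE; elementary local Galois theory).**  On O5b: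
`LocIrr W 3 ↔` no `ℚ₃`-root of `Ψ₃` (an irreducible plane has no stable line; a subgroup of order 3 is
`G_{ℚ₃}`-stable iff the common `x`-coordinate of `±P` is in `ℚ₃`).  The (A)/(B)/(C) trichotomy of the
module docstring is the statement a prover should attach here once semisimplification characters are
tree vocabulary.  **PROVED 2026-08-21 (kernel): `O5.localShapeTprimeThree_holds : LocalShapeTprimeThree`
(harvest-2 GEN 42 E89, `O5/O5LocalShapeProofs.lean` p291075, via `Literature/…/ModThreeReducibleIffPsi3Root.lean`
p290642) — indeed `LocIrr W 3 ↔ numStableLinesAtThree W = 0` for EVERY elliptic `W/ℚ`, no class hypothesis;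
feed `localShapeTprimeThree_holds` wherever `(h : LocalShapeTprimeThree)` is a binder.** [cite: Serre1972, §1.11 Prop. 10] -/
def LocalShapeTprimeThree : Prop :=
  ∀ (W : WeierstrassCurve ℚ) [W.IsElliptic] [W.IsGloballyMinimal],
    ClassO5 W 3 → SubTprime W 3 → (LocIrr W 3 ↔ numStableLinesAtThree W = 0)

/-- **G3-1′ `NonSplitAtThreeLaw` (THEOREM-CANDIDATE, census-discovered 2026-08-21, with proof sketch).**
On O5b the local residual representation is NEVER SPLIT: `W[3]` has at most one `G_{ℚ₃}`-stable line
(so in case (B) `c ≠ 0`, and `numStableLinesAtThree W = 1 ↔ ¬ LocIrr W 3`).  Sketch: over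
`L = ℚ₃^nr(3^{1/4})` (`e_L = 4`) the good model is supersingular, `[3]_F(T) = 3T + … ≡ unit·T⁹ (mod 3, deg ≥ 9)`,
so the Newton polygon of `[3]_F` runs from `(1, 4)` to `(9, 0)`, possibly broken at `(3, w)` with `w ∈ {1, 2}`;
the six non-canonical `3`-torsion points then have `v_L = w/6 ∉ ℤ` (and in the unbroken case all eight have
`v_L = 1/2`), so they are not rational over any unramified extension of `L`; but a split `ρ̄|G_{ℚ₃} = uω^a ⊕ uω^{1−a}`
is trivial on `I_L` (`ω|I_L = 1` as `√−3 ∈ L`), which would make all of `W[3]` rational over `L^nr`.  CENSUS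
(EVIDENCE, kit j129977, PARI `polrootspadic(elldivpol(W,3), 3, 12)`): exactly one root on 61 / 61 generic O5b rows
(27 type III* with companions, 10 + 10 without, 14 type III), none on 10 / 10 LocIrr rows.
[cite: Serre1972, §1.11 Prop. 10 (Newton polygon of `[p]`)] [evidence: census cell O5, o5-r1 GEN 3, kit j129977: 61/61 + 10/10] -/
def NonSplitAtThreeLaw : Prop :=
  ∀ (W : WeierstrassCurve ℚ) [W.IsElliptic] [W.IsGloballyMinimal],
    ClassO5 W 3 → SubTprime W 3 → numStableLinesAtThree W ≤ 1

/-- **G3-2 `CompanionTypeLawThree` (THEOREM — PROVED p337182 `companionTypeLawThree_holds`, harvest-2 GEN 54; was THEOREM-CANDIDATE).**  An elliptic companion `G` of an O5b curve `W`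
with `ρ̄_{W,3}` irreducible is (good) SUPERSINGULAR at `3` iff `W[3]|G_{ℚ₃}` is irreducible: `ρ̄_G ≅ ρ̄_W`,
and for `G` semistable at `3`, `G[3]|G_{ℚ₃}` is irreducible (`ω₂ ⊕ ω₂³` on inertia) iff `G` is good
supersingular iff `3 ∣ a₃(G)` (good ordinary: `(ω ∗; 0 1) ⊗ u`; multiplicative: `a₃(G) = ±1`, Tate curve,
reducible).  CENSUS (EVIDENCE, module docstring): LocIrr → good-ss only (33 204 links; good-ord 0, mult 0);
generic → good-ord 27 998 + mult 19 765, good-ss 0 after the one screened hit 446292ck1 ↔ 122150ba was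
killed by direct point counts (fails at 35 primes `101 ≤ ℓ ≤ 400`).  **PROVED 2026-08-22 (kernel): `O5.companionTypeLawThree_holds :
CompanionTypeLawThree` (harvest-2 GEN 54 E109, `O5/CompanionTypeLawThreeHolds.lean` p337182 ACCEPTED 32077e6d5fbd, over x11b3-p4 GEN 14's
`O5/CompanionTypeLawThreeOfModThreeTransport.lean` whose one binder `hBNC` — the Brauer–Nesbitt–Chebotarev transport `IsCompanionAtThree W G` ∧
`Irr ρ̄_{W,3}` ⟹ `G[3] ≃ W[3]` equivariantly — is now `Literature/…/ModPCongruenceIsomorphismProofs.lean` p335753; binders of this node verbatim,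
axioms standard) — feed `companionTypeLawThree_holds` wherever `(h : CompanionTypeLawThree)` is a binder.  The same leaf makes cc-typer-5
GEN 11's local schema `hloc` of `O5/O5KummerLineLocalSign.lean` a theorem (`isLocallyCongruentModThreeAt3_of_isCongruentModThree`), whence
`kummerLineByLocalRootNumberThree_of_relKummerLineThreeCongruent : RelKummerLineThreeCongruent → KummerLineByLocalRootNumberThree` (T24ℓ ⇐
A-O5-30 ALONE; both of those stay `@[conjecture]`).  Restamp ⟦cc-typer-5 GEN 17, rider (r7) of cc-lead ⟦gen67⟧ ADDENDUM (`class-closure/OWNERS.md` l.829, HOME/INBOX.md l.12938) on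
harvest-2's by-name landing line l.12932; DOCSTRING ONLY, decl text byte-identical; nothing booked; no mark moves; O5 OPEN⟧.**
[cite: Serre1972, §1.11 Prop. 10 and Prop. 12] [cite: Edixhoven1992, Thms. 2.5–2.6] -/
def CompanionTypeLawThree : Prop :=
  ∀ (W G : WeierstrassCurve ℚ) [W.IsElliptic] [W.IsGloballyMinimal] [G.IsElliptic] [G.IsGloballyMinimal],
    ClassO5 W 3 → SubTprime W 3 → W.HasIrreducibleModPGaloisRep 3 → IsCompanionAtThree W G →
      ((3 : ℤ) ∣ G.LFunction 3 ↔ LocIrr W 3)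

/-- **G3-2 `FlatMemberLawThree` (CONJECTURE, census-mined; EVIDENCE-labelled).**  If an O5b curve `W`
with `ρ̄_{W,3}` irreducible and NOT congruent to its own `χ₋₃`-twist (some `ℓ ∤ 3N` with `(−3/ℓ) = −1` and
`3 ∤ a_ℓ(W)`) has an elliptic companion SEMISTABLE at `3`, then `W` is the KODAIRA-III* member of its twist
pair: `v₃(Δ_min) = 9`.
Mechanism (to be made a proof; prover-sized formal-group computation or Freitas–Kraus's tables): a
weight-2 companion of level `M` or `3M`, `3 ∤ M`, has `ρ̄|G_{ℚ₃} ≅ u ⊗ (ω ∗; 0 1)` (ordinary / Steinberg) or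
`ω₂ ⊕ ω₂³` on inertia (supersingular) — Serre weight `2` or `4`, never the weight `6` of the `ω`-twisted twin
`u ⊗ (1 ∗; 0 ω)` resp. `{ω₂⁵, ω₂⁷}` (non-split by `NonSplitAtThreeLaw`, so the twins ARE distinguished); which
twin carries the weight-≤ 4 shape is a function of `v₃(Δ_min) ∈ {3, 9}` — the census says: `9` (III*).
AMENDMENT (cc-typer-5 GEN 7, 2026-08-21, doc-only; harvest-2 E88 §6.2 / §8 (3)): on the `LocIrr` rows the law
is DERIVED (FML-local): there is NO canonical subgroup there, and the mechanism is the sign of the tame generator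
on the formal PARAMETER of the good model over `ℚ₃^{nr}(3^{1/4})` — `t(gP) = (g(ϖ)/ϖ)^{±1}·g(t(P))`, `+` for
III*, `−` for III — whence the leading terms of all eight 3-torsion parameters give `W[3]|_I = {ω₂, ω₂³}`
(III*, flat) resp. `{ω₂⁵, ω₂⁷}` (III, weight 6); the reducible-local rows go through T18′ /
`NonSplitAtThreeLaw` (`O5KummerLine.lean`). Tag kept until a kernel proof.
CENSUS (EVIDENCE, cc-eng-2 link table × this seat's `census/o5_jmod_rows.tsv`, module docstring): companions
semistable at `3` attach to III* rows 4 312 / 4 317 and to III rows 17 / 3 042, all 17 being self-twist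
(image 3Nn) rows — excluded by the hypothesis; the 64 screened links of 14 generic type-III rows are screen
artefacts (0 / 64 survive `ℓ ≤ 400`).  Exceptions after cleaning: 0.  Falsifier: one non-self-twist
Kodaira-III O5b row with a CERTIFIED semistable-at-3 elliptic companion.
[evidence: census cell O5 (o5-r1 GEN 3, 2026-08-21): III* 4 312/4 317 vs III 17/3 042, 17 = self-twist, 64/64 generic links spurious]
[cite: Serre1987, §2 (weights)] [cite: BuzzardDiamondJarvis2010, §3] [cite: Edixhoven1992, Thms. 2.5–2.6] -/
@[conjecture] def FlatMemberLawThree : Prop :=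
  ∀ (W G : WeierstrassCurve ℚ) [W.IsElliptic] [W.IsGloballyMinimal] [G.IsElliptic] [G.IsGloballyMinimal],
    ClassO5 W 3 → SubTprime W 3 → W.HasIrreducibleModPGaloisRep 3 → IsCompanionAtThree W G →
    (∃ ℓ : ℕ, ℓ.Prime ∧ ¬ (ℓ ∣ 3 * W.conductorNorm ℤ) ∧ jacobiSym (-3) ℓ = -1 ∧ ¬ ((3 : ℤ) ∣ W.LFunction ℓ)) →
      padicValRat 3 W.Δ = 9

/-! ## §3 T14 — the COMPANION λ-TRANSPORT law (census law; the analytic shadow of GV1–GV3) -/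

/-- **T14 `CompanionLambdaTransportLawThree` (CONJECTURE; E4 → E3; PRE-REGISTERED before its pilot ran —
`HOME/b2b-bsdres-o5-r1/gen3/T14-PREREG.md`, frozen scorer `t14_score.frozen_51a43a3bf02875f7.py`,
kit j129977; the EVIDENCE line is appended by the typer only after scoring).**  For a generic
(`¬ LocIrr`) Kodaira-III* O5b curve `W` with big image at `3` and an ORDINARY elliptic companion `G`
(`3 ∤ N_G`, `3 ∤ a₃(G)`), `S` = the primes `≠ 3` of `N_W N_G`, and each branch `ε`, for all large layers `n`
at which `μ(θ^ε_n(G)) = 0`, both `S`-depleted layer elements are nonzero and there is room below `3^n`: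
`λ(D^ε_{S,n}(W)) = 2·3^{n−1} + λ(D^ε_{S,n}(G)) + κ(ε, u)`, `u = [a₃(G) ≡ 1 (mod 3)]`,
with `κ : {±} × {anomalous, not} → ℤ` UNIVERSAL (the same four constants for every such pair; naive
prediction `κ = 0`: `θ̄_n(W) ∝ ν(θ̄_{n−1}(G)) = X^{2·3^{n−1}}·θ̄_{n−1}(G)`, the `3`-old vector of GV2).  Since
`λ(θ^ε_n(G)) = λ(L^ε₃(G))` for `3^n > λ` when `μ = 0`, this says: the generic O5b layer `λ`-invariants
ARE the companion's `3`-adic `L`-function invariants after depletion, up to the twist shift `2·3^{n−1}`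
and a local constant — T9's "bounded `3`-adic-`L`-function-like class" made explicit.  KILL (registered):
two decided instances of one stratum `(ε, u)` with different `κ`.  MEANING for route T-O5-GV: PASS is what
GV2 ∧ GV3 predict (the Kato defect does not jump between the ordinary and the supercuspidal point of
`Spec 𝕋_𝔪`); a FAIL inside a stratum is evidence against transportability (or against IMC at `W`).
RESULT (kit j129977, 2026-08-21T10:36Z, frozen scorer, output sha256 017276767c52704b…): **PASS, κ ≡ 0** —
ordinary arm 84 / 84 decided instances with `d = 0` (28 pairs `W*` of conductor ≤ 487 872 ~ `G` of conductor
≤ 5 294, congruence re-verified at 72–75 primes `ℓ ≤ 400`; layers `n ∈ {4, 5}`; strata (+, non-anom) 23,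
(+, anom) 19, (−, non-anom) 23, (−, anom) 19; both pre-registered held-out halves separately `d ≡ 0`:
36 + 48 instances); consistency arms: multiplicative companions 32 / 32 instances `d = 0` (6 + 6 pairs, split
and non-split), PARI `ellpadiclambdamu` vs tower `λ(θ^ε_5(G))` 76 / 76, `W*` towers kit vs cc-eng-3 11 / 11
layer-branches; non-decided instances are `no room` (`n ≤ 3`), `depleted zero` or pre-`n₀` (`μ > 0` at small
`n`, e.g. 155502s1), never a mismatch.  The sharpened law with `κ = 0` and semistable companions, read off this
run and confirmed on its held-out half, is `CompanionLambdaTransportExactThree` below.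
[evidence: census cell O5, o5-r1 GEN 3, kit j129977: T14 PASS κ=0, 84/84 + 32/32, prereg `gen3/T14-PREREG.md`]
[cite: EmertonPollackWeston2006, Thm. 1 (the shape transported)] [cite: GreenbergVatsal2000, §2]
[cite: Kim2019KatoInvariants, Thm. 2.1] -/
@[conjecture] def CompanionLambdaTransportLawThree : Prop :=
  ∃ κ : Bool → Bool → ℤ,
    ∀ (W G : WeierstrassCurve ℚ) [W.IsElliptic] [W.IsGloballyMinimal] [NeZero (W.conductorNorm ℤ)]
      [G.IsElliptic] [G.IsGloballyMinimal] [NeZero (G.conductorNorm ℤ)]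
      (f : CuspForm (Gamma0 (W.conductorNorm ℤ)) 2) (g : CuspForm (Gamma0 (G.conductorNorm ℤ)) 2),
      IsNewformOf W f → IsNewformOf G g → ClassO5 W 3 → SubTprime W 3 → padicValRat 3 W.Δ = 9 →
      Kato2004.ImageContainsSL2 W 3 → ¬ LocIrr W 3 → IsCompanionAtThree W G → ¬ 3 ∣ G.conductorNorm ℤ →
      ¬ ((3 : ℤ) ∣ G.LFunction 3) →
      ∀ ε : Bool, ∃ n₀ : ℕ, ∀ n : ℕ, n₀ ≤ n →
        polyMuThree (branchElementThree g ε n) = 0 →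
        depletedElementThree ((W.conductorNorm ℤ * G.conductorNorm ℤ).primeFactors.erase 3) W f ε n ≠ 0 →
        depletedElementThree ((W.conductorNorm ℤ * G.conductorNorm ℤ).primeFactors.erase 3) G g ε n ≠ 0 →
        (polyLamThree
            (depletedElementThree ((W.conductorNorm ℤ * G.conductorNorm ℤ).primeFactors.erase 3) G g ε n) : ℤ)
          + 2 * 3 ^ (n - 1) + 10 ≤ 3 ^ n →
        (polyLamThree
            (depletedElementThree ((W.conductorNorm ℤ * G.conductorNorm ℤ).primeFactors.erase 3) W f ε n) : ℤ)
          = 2 * 3 ^ (n - 1)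
            + polyLamThree
                (depletedElementThree ((W.conductorNorm ℤ * G.conductorNorm ℤ).primeFactors.erase 3) G g ε n)
            + κ ε (decide ((((G.LFunction 3 : ℤ) : ZMod 3)) = 1))

/-- **T14♯ `CompanionLambdaTransportExactThree` (CONJECTURE, census-mined from kit j129977 and confirmed on
its pre-registered held-out half; EVIDENCE-labelled).**  Same as T14 with the universal constant EQUAL TO ZERO
and the companion allowed to be MULTIPLICATIVE at `3` (`9 ∤ N_G`, `3 ∤ a₃(G)`):
`λ(D^ε_{S,n}(W*)) = 2·3^{n−1} + λ(D^ε_{S,n}(G))` for all large `n` with `μ(θ^ε_n(G)) = 0`, both depleted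
elements nonzero and room below `3^n`.  Mechanism: since `𝔽₃[Γ_n] = 𝔽₃[T]/(T^{3^n})` is a local principal
ideal ring, the `λ`-form IS the ideal-theoretic form (`θ̄^ε_n(W*)_S` and `(γ^{3^{n−1}} − 1)²·θ̄^ε_n(G)_S` generate
the same ideal); the genuinely stronger ELEMENT-level law is T15 below (exact for ordinary companions through the
norm lift of the layer-`(n−1)` element; the naive `±T^{2·3^{n−1}}·θ̄_n(G)` is FALSE beyond relative degree
`2·3^{n−2}` on 105/105 instances, `T14-EXPLORE-EXACT.txt`).  Held-out test for the next job:
pairs disjoint from j129977's 40, `N_G ≤ 20 000`, incl. `λ(G) ≥ 3` companions and layer `n = 6`.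
[evidence: census cell O5, o5-r1 GEN 3, kit j129977: 116/116 decided instances (84 ordinary + 32 multiplicative), d = 0]
[cite: EmertonPollackWeston2006, Thm. 1] [cite: GreenbergVatsal2000, §2] -/
@[conjecture] def CompanionLambdaTransportExactThree : Prop :=
  ∀ (W G : WeierstrassCurve ℚ) [W.IsElliptic] [W.IsGloballyMinimal] [NeZero (W.conductorNorm ℤ)]
    [G.IsElliptic] [G.IsGloballyMinimal] [NeZero (G.conductorNorm ℤ)]
    (f : CuspForm (Gamma0 (W.conductorNorm ℤ)) 2) (g : CuspForm (Gamma0 (G.conductorNorm ℤ)) 2),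
    IsNewformOf W f → IsNewformOf G g → ClassO5 W 3 → SubTprime W 3 → padicValRat 3 W.Δ = 9 →
    Kato2004.ImageContainsSL2 W 3 → ¬ LocIrr W 3 → IsCompanionAtThree W G → ¬ ((3 : ℤ) ∣ G.LFunction 3) →
    ∀ ε : Bool, ∃ n₀ : ℕ, ∀ n : ℕ, n₀ ≤ n →
      polyMuThree (branchElementThree g ε n) = 0 →
      depletedElementThree ((W.conductorNorm ℤ * G.conductorNorm ℤ).primeFactors.erase 3) W f ε n ≠ 0 →
      depletedElementThree ((W.conductorNorm ℤ * G.conductorNorm ℤ).primeFactors.erase 3) G g ε n ≠ 0 →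
      (polyLamThree
          (depletedElementThree ((W.conductorNorm ℤ * G.conductorNorm ℤ).primeFactors.erase 3) G g ε n) : ℤ)
        + 2 * 3 ^ (n - 1) + 10 ≤ 3 ^ n →
      (polyLamThree
          (depletedElementThree ((W.conductorNorm ℤ * G.conductorNorm ℤ).primeFactors.erase 3) W f ε n) : ℤ)
        = 2 * 3 ^ (n - 1)
          + polyLamThree
              (depletedElementThree ((W.conductorNorm ℤ * G.conductorNorm ℤ).primeFactors.erase 3) G g ε n)

/-- The sharpened law implies the registered one (`κ := 0`; kernel bookkeeping). [folklore] -/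
theorem companionLambdaTransportLawThree_of_exact (h : CompanionLambdaTransportExactThree) :
    CompanionLambdaTransportLawThree := by
  refine ⟨fun _ _ => 0, ?_⟩
  intro W G _ _ _ _ _ _ f g hf hg h5 hT hΔ himg hgen hcomp _ hord ε
  obtain ⟨n₀, hn₀⟩ := h W G f g hf hg h5 hT hΔ himg hgen hcomp hord ε
  refine ⟨n₀, fun n hn hμ hW hG hroom => ?_⟩
  rw [hn₀ n hn hμ hW hG hroom]
  simp

/-! ## §3b T15 — EXACT mod-3 layer transport through the norm map (EXPLORATORY law mined from the T14 run;
## its held-out test is the next job — typed now because it names the vector GV2 is about) -/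

/-- The norm lift `ν_{n−1→n} : ℚ[Γ_{n−1}] → ℚ[Γ_n]`, `[σ] ↦ Σ_{τ ↦ σ} [τ]`, on representatives of degree
`< 3^{n−1}` in the variable `X = γ − 1`: multiplication by `1 + (1+X)^{3^{n−1}} + (1+X)^{2·3^{n−1}}`
(`≡ X^{2·3^{n−1}} (mod 3)`), reduced to degree `< 3^n`. [cite: MazurTate1987, §1] -/
noncomputable def normLiftThree (n : ℕ) (P : ℚ[X]) : ℚ[X] :=
  (P * (1 + (X + 1) ^ 3 ^ (n - 1) + (X + 1) ^ (2 * 3 ^ (n - 1)))) %ₘ ((X + 1) ^ 3 ^ n - 1)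

/-- CAVEAT (o5-r1 GEN 4, ASK A-O5-16; recorded by cc-typer-5 GEN 4 — DOC-ONLY, statement unchanged): the threshold
below is `μ(D_n(W))` (the depleted layer element's own content valuation); on layers where `S`-depletion already
kills `D_n(W)` mod `3^{μ*+1}` this asks for a relative mod-9 congruence that NO evidence addresses. The form the
census certifies (84/84 gen 3; held-out kit j130904 105/105 + 69/69) and that T16 implies is the FAMILY-threshold
restatement T15′ `ModThreeLayerTransportFamilyThree` (module `O5.O5OldLine`, with T16 `OldLineCongruenceThree`).
SUPERSEDE, never re-word: this node keeps its statement. ORIGINAL DOCSTRING: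
**T15 `ModThreeLayerTransportThree` (CONJECTURE; EXPLORATORY — mined 2026-08-21 from the vectors of kit
j129977 AFTER T14 passed, NOT yet held-out-validated; EVIDENCE-labelled).**  For a generic Kodaira-III* O5b
curve `W*` with big image and a good ORDINARY elliptic companion `G`, `S` the primes `≠ 3` of `N_W N_G`, each
branch `ε` and all large `n`: the `S`-depleted layer-`n` element of `W*` is, modulo `3` and up to a `3`-adic unit
scalar, EXACTLY the norm lift of the companion's `S`-depleted layer-`(n−1)` element:
`D^ε_{S,n}(W*) ≡ c · ν_{n−1→n}(D^ε_{S,n−1}(G)) (mod 3^{μ+1})`, `μ = μ(D^ε_{S,n}(W*))`, some `c ∈ ℚ^×` — typed as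
"`∃ c`, subtracting `c·ν(…)` raises the content valuation".  Equivalently, on `3`-power cusps the mod-3 modular
symbol of `f_{W*}` is `±` that of the OLD form `g(3z)`: `x̄^±_{W*}(a/3^{n+1}) = ± x̄^±_G(a/3^n)` after depletion —
NOT that of the `U₃`-kernel old vector `g − a₃(G)·g(3z)` which is `q`-expansion-congruent to `f_{W*}` (that
vector would give `λ(W*) = λ(G)`, refuted by T9/T14).  Heuristic (ours): `x_{g(3z)}` spans the `w₉`-eigen old
line, and the geometric involution `w₉` reduces well mod `3` while `U₃` (non-semisimple mod `3` on the old
space at `9M`, the multiplicity-two phenomenon F-O5-M2) does not.  T15 ⇒ T14♯ for ordinary companions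
(`λ(ν x) = 2·3^{n−1} + λ(x)`, `λ(D_{n−1}(G)) = λ(D_n(G))` once stabilised).  CENSUS (EXPLORATORY EVIDENCE,
`gen3/t14_pilot/T14-EXPLORE-EXACT.txt`): all `3^n` coefficients agree up to a global sign on **84 / 84**
ordinary-companion instances (28 pairs, `n ∈ {4, 5}`, both branches, `a₃(G) ∈ {±1, ±2}`); for MULTIPLICATIVE
companions it FAILS — first deviation at relative degree exactly `2·3^{n−2}` on 29 / 29 instances where that
degree is visible (the remaining 3 have it beyond `3^n`), i.e. `D_n(W*) ≡ ±ν(D_{n−1}(G)) (mod X^{2·3^{n−1}+2·3^{n−2}+λ})`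
only; the correct old vector for a `3`-new companion is OPEN (half the cases fit `ν(D_{n−1} + a₃ν′D_{n−2})`).
MEANING for GV2: names the line in the old space to which the supercuspidal zeta element / symbol reduces
mod `3` — the `V₃`-degeneracy image of the companion's, which is what a transport of Kato's `ℍ¹/z` through the
congruence must use.  Held-out test: the next T14♯ job (disjoint pairs) scores T15 coefficientwise.
[evidence: census cell O5, o5-r1 GEN 3, kit j129977 vectors: 84/84 ordinary exact, 0/29 multiplicative]
[cite: MazurTate1987, §1] [cite: GreenbergVatsal2000, §2] [cite: EmertonPollackWeston2006, Thm. 1] -/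
@[conjecture] def ModThreeLayerTransportThree : Prop :=
  ∀ (W G : WeierstrassCurve ℚ) [W.IsElliptic] [W.IsGloballyMinimal] [NeZero (W.conductorNorm ℤ)]
    [G.IsElliptic] [G.IsGloballyMinimal] [NeZero (G.conductorNorm ℤ)]
    (f : CuspForm (Gamma0 (W.conductorNorm ℤ)) 2) (g : CuspForm (Gamma0 (G.conductorNorm ℤ)) 2),
    IsNewformOf W f → IsNewformOf G g → ClassO5 W 3 → SubTprime W 3 → padicValRat 3 W.Δ = 9 →
    Kato2004.ImageContainsSL2 W 3 → ¬ LocIrr W 3 → IsCompanionAtThree W G → ¬ 3 ∣ G.conductorNorm ℤ →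
    ¬ ((3 : ℤ) ∣ G.LFunction 3) →
    ∀ ε : Bool, ∃ n₀ : ℕ, ∀ n : ℕ, n₀ ≤ n →
      depletedElementThree ((W.conductorNorm ℤ * G.conductorNorm ℤ).primeFactors.erase 3) W f ε n ≠ 0 →
      ∃ c : ℚ,
        polyMuThree (depletedElementThree ((W.conductorNorm ℤ * G.conductorNorm ℤ).primeFactors.erase 3) W f ε n)
          < polyMuThree
              (depletedElementThree ((W.conductorNorm ℤ * G.conductorNorm ℤ).primeFactors.erase 3) W f ε n
                - C c * normLiftThree n
                    (depletedElementThree ((W.conductorNorm ℤ * G.conductorNorm ℤ).primeFactors.erase 3)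
                      G g ε (n - 1)))

/-! ## §4 GV2 — constancy of the KATO DEFECT (research crux over the Kato-datum INTERFACE):
## MOVED VERBATIM to the sibling module `O5.O5KatoDefect` (cc-typer-5 GEN 4, lint-forced split by topic —
## `KatoIwasawaInvariants`, `katoDefect`, `KatoDefectConstancyThree`, `kmc_of_companion`). -/

end Summit.BirchSwinnertonDyer.Rank1Residual.O5

end
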